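import Mathlib
import Literature.NumberTheory.LFunctions.Zhang2022.Section8Lemma84LBounds
import Literature.NumberTheory.LFunctions.Zhang2022.Section8LFunctionFloor
import Literature.NumberTheory.LFunctions.Zhang2022.Section5Lemma54Discharge
import Literature.NumberTheory.LFunctions.Zhang2022.Section5DeltaAnalytic
import Literature.Analysis.Complex.VerticalLineShift
import Literature.Analysis.Complex.RectangleResidueSimplePoles
import Literature.Analysis.Complex.RectangleContourTools
import HarnessLib

/-!
# Zhang (2022) §15 p. 82 / §16 p. 90 ("in a way similar to the treatment of (7.19)"): the contour
# shift of a `Δ`-Mellin line integral with the factor `1/L(s,χ)` to the exceptional zero —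
# preliminaries (the integrand, the line shift `σ = 2 → σ = 1 + α`, the simple pole at `ρ̃`)

Topic `Literature/NumberTheory/LFunctions/Zhang2022` (Landau–Siegel audit tree; verdict-neutral).
Y. Zhang, *Discrete mean estimates and the Landau–Siegel zero*, arXiv:2211.02515v1 (2022)
[Zhang2022LandauSiegel] — **an unrefereed manuscript under adjudication** (ZHANG-L discharge lane).
DAG nodes served: `Z22:§15.u021` [Z22 p.82, tex L4129] and `Z22:§16.u015` [Z22 p.90, tex L4484], both
of the printed shape "the expression (15.8)/(16.4) `(1/2πi)∫_{(2)} G(s)L(s,χ)⁻¹ yˢ δ(s) ds` is equal to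
the residue of the integrand at `s = ρ̃` plus an acceptable error; by (5.15) we can replace `ρ̃` by `1`",
with `G = κ̃₁λ₁·L(s+β₁,χ)L(s+β₂,χ)` resp. `G = κ̃₂λ₂·L(s+β₁,χ)`, `y = Dpk/l₂`, `δ` = `Skeleton.deltaW`
((5.14), the Mellin transform of `Δ`).

This file is the first half of ONE engine for both nodes, GENERIC in the holomorphic factor `G`:
for an arbitrary `G` (differentiable on `σ > 9/10`), a character `χ ≠ χ₀ (mod D)`, `y > 0` and the
integrand `F(s) = G(s)·L(s,χ)⁻¹·yˢ·δ(s)` (passed as a function `F` with a defining hypothesis `hF`,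
so that no definition is introduced):

* `differentiableAt_integrand` — `F` is holomorphic wherever `σ > 9/10` and `L(s,χ) ≠ 0`;
* `norm_integrand_le_of_one_lt` — on a strip `b ≤ σ ≤ 2` with `b > 1`:
  `‖F(σ+it)‖ ≤ M·((b/(b−1))·y²·C_δ𝓛⁵¹⁹⁰)·(1+t²)⁻¹` from `‖L⁻¹‖ ≤ b/(b−1)` (tree
  `Lemma84.inv_LFunction_le_right`) and Lemma 5.4 (i) (tree `Skeleton.norm_deltaW_le`);
* `integral_line_two_eq` — the pole-free line shift `∫F(2+it)dt = ∫F(b+it)dt` for `1 < b ≤ 2`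
  (tree `Literature.Analysis.Complex.integral_vertical_eq_of_differentiableOn`);
* `exists_pole_form` — at a simple real zero `ρ` of `L(·,χ)` the integrand is `φ(z)/(z − ρ)` with
  `φ = G·yᶻ·δ/dslope L ρ` holomorphic near `ρ` and `φ(ρ) = G(ρ)y^ρδ(ρ)/L′(ρ,χ)` (the shape consumed
  by the tree's `rectBoundaryIntegral_eq_sum_of_simplePoles`);
* `rect_eq_residue` — the residue theorem on a rectangle `[a,b] × [−T,T]` around `ρ` lying in a
  zero-free region of the classical shape `σ ≥ 1 − c/(log D + log(|t|+4))` with `ρ` its only zero;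
* `norm_far_pieces_le`, `norm_left_piece_le`, `norm_horizontal_piece_le` — the "standard estimates"
  for the pieces of the shifted contour (far part of `σ = b`, left side `σ = a`, horizontal sides);
* `norm_lineInt_sub_residue_le` — Part 1 assembled in abstract form:
  `‖(1/2πi)∫_{(2)}F − G(ρ)y^ρδ(ρ)/L′(ρ,χ)‖ ≤` (far pieces) + (left side) + (horizontal sides).
The companion file `DeltaContourShift.lean` replaces `ρ` by `1` and fixes Zhang's parameters.

No new definitions, no named facts, no `sorry`; nothing here uses (A) or asserts anything about
Theorems 1–2 of the source or about Landau–Siegel zeros.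

## References

* Y. Zhang, arXiv:2211.02515v1 (2022), §15 p. 82 (tex L4129), §16 p. 90 (tex L4484), §7 p. 40
  (the treatment of (7.19)), §5 (5.14), Lemma 5.4. [cite: Zhang2022LandauSiegel, §15 p.82; §16 p.90]
* J. B. Conway, *Functions of One Complex Variable I*, 2nd ed. (1978), Ch. V Thm. 2.2 (residue
  theorem, via the tree's `RectangleResidueSimplePoles`). [cite: Conway1978, Ch. V Thm. 2.2]
-/

noncomputable section

open Complex Real MeasureTheory Set Filter Topology

namespace Literature.NumberTheory.LFunctions.Zhang2022.DeltaContourShift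

open Literature.NumberTheory.LFunctions.Zhang2022.Skeleton

/-! ## §0. Parameters -/

/-- From `𝓛 ≥ 4`: `D ≥ 3` (as a real and as a natural number), `D = e^𝓛`, `0 < α ≤ 𝓛⁻¹ ≤ 1/4`,
`α · log P = π`, `log P = 𝓛⁹` (`α = π/𝓛⁹`). [cite: Zhang2022LandauSiegel, §2 (2.1), (2.6), (2.10)] -/
theorem param_facts {D : ℕ} (hℓ4 : 4 ≤ ell D) :
    (3 : ℝ) ≤ D ∧ 3 ≤ D ∧ (D : ℝ) = Real.exp (ell D) ∧ 0 < alpha D ∧ alpha D ≤ (ell D)⁻¹ ∧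
      (ell D)⁻¹ ≤ 1 / 4 ∧ alpha D * Real.log (bigP D) = π ∧ Real.log (bigP D) = ell D ^ 9 ∧
      alpha D = π / ell D ^ 9 := by
  set ℓ := ell D with hℓdef
  have hℓ0 : 0 < ℓ := by linarith
  have hD0 : (0 : ℝ) < D := by
    by_contra h
    rw [not_lt] at h
    have hD0' : (D : ℝ) = 0 := le_antisymm h (Nat.cast_nonneg D)
    have : ℓ = 0 := by rw [hℓdef, ell, hD0', Real.log_zero]
    linarith
  have hDexp : (D : ℝ) = Real.exp ℓ := by rw [hℓdef, ell, Real.exp_log hD0]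
  have hD3 : (3 : ℝ) ≤ D := by
    rw [hDexp]
    have h4 : Real.exp 4 ≤ Real.exp ℓ := Real.exp_le_exp.mpr hℓ4
    have he : (3 : ℝ) ≤ Real.exp 4 := by
      have := Real.add_one_le_exp (4 : ℝ); linarith
    linarith
  have hD3' : 3 ≤ D := by exact_mod_cast hD3
  have hlogP : Real.log (bigP D) = ℓ ^ 9 := by rw [bigP, Real.log_exp]
  have hα : alpha D = π / ℓ ^ 9 := by rw [alpha, hlogP]
  have hℓ9 : 0 < ℓ ^ 9 := by positivity
  have hαpos : 0 < alpha D := by rw [hα]; positivity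
  have hαℓ : alpha D ≤ ℓ⁻¹ := by
    rw [hα, div_le_iff₀ hℓ9]
    have h8 : (4 : ℝ) ^ 8 ≤ ℓ ^ 8 := by gcongr
    calc π ≤ 4 := Real.pi_lt_four.le
      _ ≤ ℓ⁻¹ * ℓ ^ 9 := by
          rw [show ℓ⁻¹ * ℓ ^ 9 = ℓ ^ 8 by field_simp]
          nlinarith [h8]
  have hℓinv : ℓ⁻¹ ≤ 1 / 4 := by
    rw [inv_eq_one_div]; exact one_div_le_one_div_of_le (by norm_num) hℓ4
  have hαlogP : alpha D * Real.log (bigP D) = π := by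
    rw [hα, hlogP]; field_simp
  exact ⟨hD3, hD3', hDexp, hαpos, hαℓ, hℓinv, hαlogP, hlogP, hα⟩

/-- `𝓛₂ = 𝓛⁴⁰⁰ ≥ 1` once `𝓛 ≥ 1`. [cite: Zhang2022LandauSiegel, §2 (2.15)] -/
theorem one_le_ell2 {D : ℕ} (hℓ : 1 ≤ ell D) : 1 ≤ ell2 D := by
  rw [ell2]; exact one_le_pow₀ hℓ

/-- The absolute constant of Lemma 5.4 (i) in the tree's explicit form (`Skeleton.norm_deltaW_le`):
`‖δ(s)‖ ≤ C_δ·𝓛⁵¹⁹⁰·‖s‖⁻²` on `1/2 ≤ σ ≤ 2`; here packaged as an existential with `0 ≤ C_δ`.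
[cite: Zhang2022LandauSiegel, §5 Lemma 5.4 (i)] -/
theorem exists_deltaW_bound :
    ∃ Cδ : ℝ, 0 ≤ Cδ ∧ ∀ (D : ℕ), 1 ≤ ell D → ∀ s : ℂ, 1 / 2 ≤ s.re → s.re ≤ 2 →
      ‖deltaW D s‖ ≤ Cδ * ell D ^ 5190 * ‖s‖⁻¹ ^ 2 := by
  have hJ0 : 0 ≤ Lemma53.Jconst 1 2 := Lemma53.Jconst_nonneg' 1 2
  refine ⟨2 * Lemma53.Jconst 1 2
      + 4 * ((2 + Real.exp 1) * (4 * π) ^ 2 * Real.exp (((5 : ℕ) : ℝ) ^ 2)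
          + (Real.exp 1 * ((2 * 5).factorial : ℝ) + 5 ^ 5) * Lemma53.Jconst 1 2),
    by positivity, fun D hL s h1 h2 => norm_deltaW_le hL h1 h2⟩

/-! ## §1. The integrand `F(s) = G(s)·L(s,χ)⁻¹·yˢ·δ(s)` to the right of `σ = 9/10` -/

section Integrand

variable {D : ℕ} [NeZero D] {χ : DirichletCharacter ℂ D} {G F : ℂ → ℂ} {y : ℝ}

/-- The half-plane `σ > 9/10` is open. [folklore] -/
private theorem isOpen_re_gt : IsOpen {s : ℂ | 9 / 10 < s.re} :=
  isOpen_lt continuous_const Complex.continuous_re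

/-- **Holomorphy of the integrand** at every `z` with `Re z > 9/10` and `L(z,χ) ≠ 0` (`χ ≠ χ₀`,
`y > 0`, `𝓛 ≥ 1` so that `δ` is holomorphic on `σ > 0`, tree `Lemma53.differentiableOn_delta514`).
[cite: Zhang2022LandauSiegel, §15 p.82] -/
theorem differentiableAt_integrand (hχ : χ ≠ 1) (hG : DifferentiableOn ℂ G {s : ℂ | 9 / 10 < s.re})
    (hy : 0 < y) (hF : ∀ s, F s = G s * (χ.LFunction s)⁻¹ * (y : ℂ) ^ s * deltaW D s)
    (hℓ : 1 ≤ ell D) {z : ℂ} (hz : 9 / 10 < z.re) (hL : χ.LFunction z ≠ 0) :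
    DifferentiableAt ℂ F z := by
  have hFeq : F = fun s => G s * (χ.LFunction s)⁻¹ * (y : ℂ) ^ s * deltaW D s := funext hF
  rw [hFeq]
  have h1 : DifferentiableAt ℂ G z := hG.differentiableAt (isOpen_re_gt.mem_nhds hz)
  have h2 : DifferentiableAt ℂ (fun s => (χ.LFunction s)⁻¹) z :=
    ((DirichletCharacter.differentiable_LFunction hχ) z).inv hL
  have h3 : DifferentiableAt ℂ (fun s : ℂ => (y : ℂ) ^ s) z :=
    differentiableAt_id.const_cpow (Or.inl (Complex.ofReal_ne_zero.mpr hy.ne'))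
  have h4 : DifferentiableAt ℂ (deltaW D) z := by
    have hd := Lemma53.differentiableOn_delta514 (one_le_ell2 hℓ) (t0 D)
    have hmem : z ∈ {s : ℂ | 0 < s.re} := by
      show 0 < z.re; linarith
    exact hd.differentiableAt ((isOpen_lt continuous_const Complex.continuous_re).mem_nhds hmem)
  exact ((h1.mul h2).mul h3).mul h4

/-- **Size of the integrand on a strip `b ≤ σ ≤ 2` right of `1`** (`1 < b`, `1 ≤ y`, `𝓛 ≥ 1`): if
`‖G‖ ≤ M` there, then `‖F(s)‖ ≤ M·(b/(b−1))·y²·(C_δ𝓛⁵¹⁹⁰)·(1 + (Im s)²)⁻¹` — from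
`‖L(s,χ)⁻¹‖ ≤ b/(b−1)` (tree `Lemma84.inv_LFunction_le_right`), `|yˢ| = y^σ ≤ y²`, and Lemma 5.4 (i)
with `‖s‖² ≥ 1 + t²`. [cite: Zhang2022LandauSiegel, §5 Lemma 5.4 (i); §7 p.40] -/
theorem norm_integrand_le_of_one_lt (hy : 1 ≤ y)
    (hF : ∀ s, F s = G s * (χ.LFunction s)⁻¹ * (y : ℂ) ^ s * deltaW D s)
    (hℓ : 1 ≤ ell D) {Cδ : ℝ} (hCδ0 : 0 ≤ Cδ)
    (hCδ : ∀ s : ℂ, 1 / 2 ≤ s.re → s.re ≤ 2 → ‖deltaW D s‖ ≤ Cδ * ell D ^ 5190 * ‖s‖⁻¹ ^ 2)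
    {b M : ℝ} (hb : 1 < b) (hM : 0 ≤ M) (hGM : ∀ s : ℂ, b ≤ s.re → s.re ≤ 2 → ‖G s‖ ≤ M)
    {s : ℂ} (hsb : b ≤ s.re) (hs2 : s.re ≤ 2) :
    ‖F s‖ ≤ M * (b / (b - 1)) * y ^ 2 * (Cδ * ell D ^ 5190) * (1 + s.im ^ 2)⁻¹ := by
  have hy0 : 0 < y := by linarith
  rw [hF s, norm_mul, norm_mul, norm_mul]
  -- the four factors
  have e1 : ‖G s‖ ≤ M := hGM s hsb hs2
  have e2 : ‖(χ.LFunction s)⁻¹‖ ≤ b / (b - 1) := by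
    have h := (Lemma84.inv_LFunction_le_right χ (a := b - 1) (by linarith) (s := s) (by linarith)).2
    have : (1 + (b - 1)) / (b - 1) = b / (b - 1) := by ring_nf
    rw [this] at h; exact h
  have e3 : ‖(y : ℂ) ^ s‖ ≤ y ^ 2 := by
    rw [Complex.norm_cpow_eq_rpow_re_of_pos hy0]
    calc y ^ s.re ≤ y ^ (2 : ℝ) := Real.rpow_le_rpow_of_exponent_le hy hs2
      _ = y ^ 2 := by norm_num
  have hns : 1 + s.im ^ 2 ≤ ‖s‖ ^ 2 := by
    rw [Complex.sq_norm, Complex.normSq_apply]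
    have : 1 ≤ s.re * s.re := by nlinarith
    nlinarith
  have e4 : ‖deltaW D s‖ ≤ Cδ * ell D ^ 5190 * (1 + s.im ^ 2)⁻¹ := by
    refine (hCδ s (by linarith) hs2).trans ?_
    have hpos : 0 < 1 + s.im ^ 2 := by positivity
    have : ‖s‖⁻¹ ^ 2 ≤ (1 + s.im ^ 2)⁻¹ := by
      rw [inv_pow]; exact inv_anti₀ hpos hns
    exact mul_le_mul_of_nonneg_left this (by positivity)
  have hb0 : 0 ≤ b / (b - 1) := div_nonneg (by linarith) (by linarith)
  calc ‖G s‖ * ‖(χ.LFunction s)⁻¹‖ * ‖(y : ℂ) ^ s‖ * ‖deltaW D s‖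
      ≤ M * (b / (b - 1)) * y ^ 2 * (Cδ * ell D ^ 5190 * (1 + s.im ^ 2)⁻¹) := by
        gcongr
    _ = _ := by ring

/-- **Continuity of the integrand along a vertical line `σ > 1`** (no zero of `L(s,χ)` there).
[cite: Zhang2022LandauSiegel, §15 p.82] -/
theorem continuous_integrand_line (hχ : χ ≠ 1) (hG : DifferentiableOn ℂ G {s : ℂ | 9 / 10 < s.re})
    (hy : 0 < y) (hF : ∀ s, F s = G s * (χ.LFunction s)⁻¹ * (y : ℂ) ^ s * deltaW D s)
    (hℓ : 1 ≤ ell D) {σ : ℝ} (hσ : 1 < σ) :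
    Continuous fun t : ℝ => F ((σ : ℂ) + t * I) := by
  have hline : Continuous fun t : ℝ => (σ : ℂ) + t * I := by fun_prop
  refine continuous_iff_continuousAt.mpr fun t => ?_
  have hz : 9 / 10 < ((σ : ℂ) + t * I).re := by simp; linarith
  have hL : χ.LFunction ((σ : ℂ) + t * I) ≠ 0 :=
    DirichletCharacter.LFunction_ne_zero_of_one_le_re χ (Or.inl hχ) (by simp; linarith)
  exact ContinuousAt.comp (f := fun t : ℝ => (σ : ℂ) + t * I) (g := F)
    (differentiableAt_integrand hχ hG hy hF hℓ hz hL).continuousAt hline.continuousAt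

/-- **Integrability along the lines `σ ∈ [b, 2]`** (`1 < b`), by domination with `K(1+t²)⁻¹`.
[cite: Zhang2022LandauSiegel, §15 p.82] -/
theorem integrable_integrand_line (hχ : χ ≠ 1) (hG : DifferentiableOn ℂ G {s : ℂ | 9 / 10 < s.re})
    (hy : 1 ≤ y) (hF : ∀ s, F s = G s * (χ.LFunction s)⁻¹ * (y : ℂ) ^ s * deltaW D s)
    (hℓ : 1 ≤ ell D) {Cδ : ℝ} (hCδ0 : 0 ≤ Cδ)
    (hCδ : ∀ s : ℂ, 1 / 2 ≤ s.re → s.re ≤ 2 → ‖deltaW D s‖ ≤ Cδ * ell D ^ 5190 * ‖s‖⁻¹ ^ 2)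
    {b M : ℝ} (hb : 1 < b) (hM : 0 ≤ M) (hGM : ∀ s : ℂ, b ≤ s.re → s.re ≤ 2 → ‖G s‖ ≤ M)
    {σ : ℝ} (hσb : b ≤ σ) (hσ2 : σ ≤ 2) :
    Integrable fun t : ℝ => F ((σ : ℂ) + t * I) := by
  have hy0 : 0 < y := by linarith
  refine Integrable.mono'
    (integrable_inv_one_add_sq.const_mul (M * (b / (b - 1)) * y ^ 2 * (Cδ * ell D ^ 5190)))
    (continuous_integrand_line hχ hG hy0 hF hℓ (lt_of_lt_of_le hb hσb)).aestronglyMeasurable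
    (Eventually.of_forall fun t => ?_)
  have h := norm_integrand_le_of_one_lt hy hF hℓ hCδ0 hCδ hb hM hGM (s := (σ : ℂ) + t * I)
    (by simp; exact hσb) (by simp; exact hσ2)
  simpa using h

/-- **The pole-free line shift `σ = 2 → σ = b`** (`1 < b ≤ 2`): `∫F(2+it)dt = ∫F(b+it)dt`, since
`F` is holomorphic on `b ≤ σ ≤ 2` (`L(s,χ) ≠ 0` for `σ ≥ 1`), integrable on both lines and
`O((1+T²)⁻¹)` on the horizontal cross-sections. [cite: Zhang2022LandauSiegel, §7 p.40; §15 p.82] -/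
theorem integral_line_two_eq (hχ : χ ≠ 1) (hG : DifferentiableOn ℂ G {s : ℂ | 9 / 10 < s.re})
    (hy : 1 ≤ y) (hF : ∀ s, F s = G s * (χ.LFunction s)⁻¹ * (y : ℂ) ^ s * deltaW D s)
    (hℓ : 1 ≤ ell D) {Cδ : ℝ} (hCδ0 : 0 ≤ Cδ)
    (hCδ : ∀ s : ℂ, 1 / 2 ≤ s.re → s.re ≤ 2 → ‖deltaW D s‖ ≤ Cδ * ell D ^ 5190 * ‖s‖⁻¹ ^ 2)
    {b M : ℝ} (hb : 1 < b) (hb2 : b ≤ 2) (hM : 0 ≤ M)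
    (hGM : ∀ s : ℂ, b ≤ s.re → s.re ≤ 2 → ‖G s‖ ≤ M) :
    ∫ t : ℝ, F ((2 : ℝ) + t * I) = ∫ t : ℝ, F ((b : ℂ) + t * I) := by
  have hy0 : 0 < y := by linarith
  set K : ℝ := M * (b / (b - 1)) * y ^ 2 * (Cδ * ell D ^ 5190) with hK
  have hK0 : 0 ≤ K := by
    have : 0 ≤ b / (b - 1) := div_nonneg (by linarith) (by linarith)
    positivity
  have hstrip : DifferentiableOn ℂ F (Complex.re ⁻¹' Icc b 2) := by
    intro z hz
    have hz1 : 1 < z.re := lt_of_lt_of_le hb hz.1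
    exact (differentiableAt_integrand hχ hG hy0 hF hℓ (by linarith)
      (DirichletCharacter.LFunction_ne_zero_of_one_le_re χ (Or.inl hχ) hz1.le)).differentiableWithinAt
  have hIb := integrable_integrand_line hχ hG hy hF hℓ hCδ0 hCδ hb hM hGM le_rfl hb2
  have hI2 := integrable_integrand_line hχ hG hy hF hℓ hCδ0 hCδ hb hM hGM hb2 le_rfl
  have hdecay : ∀ ε : ℝ, 0 < ε → ∃ T₀ : ℝ, ∀ T : ℝ, T₀ ≤ |T| → ∀ x ∈ Icc b 2,
      ‖F ((x : ℂ) + T * I)‖ ≤ ε := by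
    intro ε hε
    refine ⟨Real.sqrt (K / ε), fun T hT x hx => ?_⟩
    have h := norm_integrand_le_of_one_lt hy hF hℓ hCδ0 hCδ hb hM hGM (s := (x : ℂ) + T * I)
      (by simp; exact hx.1) (by simp; exact hx.2)
    have him : ((x : ℂ) + T * I).im = T := by simp
    rw [him] at h
    refine h.trans ?_
    rw [← hK]
    have hT2 : K / ε ≤ T ^ 2 := by
      have h1 : Real.sqrt (K / ε) ^ 2 = K / ε := Real.sq_sqrt (div_nonneg hK0 hε.le)
      have h2 : Real.sqrt (K / ε) ^ 2 ≤ |T| ^ 2 := by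
        gcongr
      rw [h1, sq_abs] at h2; exact h2
    have hpos : 0 < 1 + T ^ 2 := by positivity
    rw [mul_inv_le_iff₀ hpos]
    rw [div_le_iff₀ hε] at hT2
    nlinarith
  have h := Literature.Analysis.Complex.integral_vertical_eq_of_differentiableOn hb2 hstrip hIb hI2 hdecay
  exact h.symm


/-- **The simple pole of the integrand at a real simple zero `ρ` of `L(·,χ)`** (`ρ > 9/10`,
`L(ρ,χ) = 0`, `L′(ρ,χ) ≠ 0`), in the concrete shape required by the tree's residue theorem
`rectBoundaryIntegral_eq_sum_of_simplePoles`: near `ρ`, `F(z) = φ(z)/(z − ρ)` with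
`φ = G·yᶻ·δ/ψ`, `ψ = dslope L ρ` (so `L(z) = (z − ρ)ψ(z)`, `ψ(ρ) = L′(ρ,χ) ≠ 0`), `φ` holomorphic
near `ρ` and `φ(ρ) = G(ρ)y^ρδ(ρ)/L′(ρ,χ)` — the residue. [cite: Zhang2022LandauSiegel, §15 p.82]
[cite: Conway1978, Ch. V Thm. 2.2] -/
theorem exists_pole_form (hχ : χ ≠ 1) (hG : DifferentiableOn ℂ G {s : ℂ | 9 / 10 < s.re})
    (hy : 0 < y) (hF : ∀ s, F s = G s * (χ.LFunction s)⁻¹ * (y : ℂ) ^ s * deltaW D s)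
    (hℓ : 1 ≤ ell D) {ρ : ℝ} (hρ9 : 9 / 10 < ρ) (hLρ : χ.LFunction ρ = 0)
    (hL'ρ : deriv χ.LFunction ρ ≠ 0) :
    ∃ φ : ℂ → ℂ, ∃ V ∈ 𝓝 (ρ : ℂ), DifferentiableOn ℂ φ V ∧
      φ ρ = G ρ * (y : ℂ) ^ (ρ : ℂ) * deltaW D ρ / deriv χ.LFunction ρ ∧
      ∀ z ∈ V, z ≠ ρ → F z = φ z / (z - ρ) := by
  set ψ : ℂ → ℂ := dslope χ.LFunction (ρ : ℂ) with hψ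
  have hLd : Differentiable ℂ χ.LFunction := DirichletCharacter.differentiable_LFunction hχ
  have hψd : Differentiable ℂ ψ := by
    have h := (Complex.differentiableOn_dslope (f := χ.LFunction) (c := (ρ : ℂ))
      (Filter.univ_mem : (Set.univ : Set ℂ) ∈ 𝓝 (ρ : ℂ))).mpr hLd.differentiableOn
    exact differentiableOn_univ.mp h
  have hψρ : ψ ρ = deriv χ.LFunction ρ := by rw [hψ, dslope_same]
  have hψne : ∀ᶠ z in 𝓝 (ρ : ℂ), ψ z ≠ 0 :=
    (hψd (ρ : ℂ)).continuousAt.eventually_ne (by rw [hψρ]; exact hL'ρ)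
  have hre : ∀ᶠ z in 𝓝 (ρ : ℂ), 9 / 10 < z.re :=
    isOpen_re_gt.mem_nhds (by show 9 / 10 < (ρ : ℂ).re; simpa using hρ9)
  obtain ⟨V, hVsub, hVopen, hρV⟩ := _root_.eventually_nhds_iff.mp (hψne.and hre)
  refine ⟨fun z => G z * (y : ℂ) ^ z * deltaW D z / ψ z, V, hVopen.mem_nhds hρV, ?_, ?_, ?_⟩
  · intro z hz
    obtain ⟨hψz, hz9⟩ := hVsub z hz
    have h1 : DifferentiableAt ℂ G z := hG.differentiableAt (isOpen_re_gt.mem_nhds hz9)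
    have h3 : DifferentiableAt ℂ (fun s : ℂ => (y : ℂ) ^ s) z :=
      differentiableAt_id.const_cpow (Or.inl (Complex.ofReal_ne_zero.mpr hy.ne'))
    have h4 : DifferentiableAt ℂ (deltaW D) z := by
      have hd := Lemma53.differentiableOn_delta514 (one_le_ell2 hℓ) (t0 D)
      have hmem : z ∈ {s : ℂ | 0 < s.re} := by
        show 0 < z.re; linarith
      exact hd.differentiableAt ((isOpen_lt continuous_const Complex.continuous_re).mem_nhds hmem)
    exact (((h1.mul h3).mul h4).div (hψd z) hψz).differentiableWithinAt
  · simp only []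
    rw [hψρ]
  · intro z hz hzρ
    obtain ⟨hψz, -⟩ := hVsub z hz
    have hsub : z - (ρ : ℂ) ≠ 0 := sub_ne_zero.mpr hzρ
    have hLz : χ.LFunction z = (z - ρ) * ψ z := by
      have h := sub_smul_dslope χ.LFunction (ρ : ℂ) z
      rw [smul_eq_mul, hLρ, sub_zero] at h
      rw [hψ]; exact h.symm
    rw [hF z, hLz]
    field_simp

end Integrand

/-! ## §2. The zero-free region as an open set; the residue theorem on `[a, b] × [−T, T]` -/

section Rectangle

variable {D : ℕ} [NeZero D] {χ : DirichletCharacter ℂ D} {G F : ℂ → ℂ} {y : ℝ}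

/-- `log D + log(|t| + 4) > 0` for a natural number `D`. [folklore] -/
private theorem logsum_pos (D : ℕ) (t : ℝ) : 0 < Real.log D + Real.log (|t| + 4) := by
  have h1 : 0 ≤ Real.log (D : ℝ) := Real.log_natCast_nonneg D
  have h2 : 0 < Real.log (|t| + 4) := Real.log_pos (by linarith [abs_nonneg t])
  linarith

/-- The region `{9/10 < σ, 1 − c/(log D + log(|t|+4)) < σ}` (the classical zero-free region shape,
opened up) is an open set. [folklore] -/
private theorem isOpen_region (c : ℝ) (D : ℕ) :
    IsOpen {s : ℂ | 9 / 10 < s.re ∧ 1 - c / (Real.log D + Real.log (|s.im| + 4)) < s.re} := by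
  have hcont : Continuous fun s : ℂ => 1 - c / (Real.log D + Real.log (|s.im| + 4)) := by
    have h1 : Continuous fun s : ℂ => Real.log (|s.im| + 4) :=
      Continuous.log (by fun_prop) fun s => by linarith [abs_nonneg s.im]
    have h2 : Continuous fun s : ℂ => Real.log D + Real.log (|s.im| + 4) :=
      continuous_const.add h1
    exact continuous_const.sub (continuous_const.div h2 fun s => (logsum_pos D s.im).ne')
  exact (isOpen_lt continuous_const Complex.continuous_re).inter (isOpen_lt hcont Complex.continuous_re)

/-- Monotonicity of the region in `|t|`: if `|t| ≤ T` then
`1 − c/(log D + log(|t|+4)) ≤ 1 − c/(log D + log(T+4))` (`c ≥ 0`). [folklore] -/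
private theorem region_mono {c : ℝ} (hc : 0 ≤ c) (D : ℕ) {t T : ℝ} (ht : |t| ≤ T) :
    1 - c / (Real.log D + Real.log (|t| + 4)) ≤ 1 - c / (Real.log D + Real.log (T + 4)) := by
  have h0 := logsum_pos D t
  have hT : |T| = T := abs_of_nonneg ((abs_nonneg t).trans ht)
  have h1 : Real.log (|t| + 4) ≤ Real.log (T + 4) :=
    Real.log_le_log (by linarith [abs_nonneg t]) (by linarith)
  have h2 : c / (Real.log D + Real.log (T + 4)) ≤ c / (Real.log D + Real.log (|t| + 4)) :=
    div_le_div_of_nonneg_left hc h0 (by linarith)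
  linarith

/-- **The residue theorem for the integrand on a rectangle around the exceptional zero.** Let
`χ ≠ χ₀`, `y > 0`, `𝓛 ≥ 1`; let `ρ > 9/10` be a real simple zero of `L(·,χ)` which is the ONLY zero
of `L(·,χ)` in the region `σ ≥ 1 − c/(log D + log(|t|+4))` (`c > 0`); and let `[a,b] × [−T,T]`
(`9/10 < a < ρ < b`, `T > 0`) lie inside that region (`1 − c/(log D + log(T+4)) < a`). Then
`∮_{∂([a,b]×[−T,T])} F = 2πi · G(ρ)y^ρδ(ρ)/L′(ρ,χ)`. [cite: Zhang2022LandauSiegel, §15 p.82]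
[cite: Conway1978, Ch. V Thm. 2.2] -/
theorem rect_eq_residue (hχ : χ ≠ 1) (hG : DifferentiableOn ℂ G {s : ℂ | 9 / 10 < s.re})
    (hy : 0 < y) (hF : ∀ s, F s = G s * (χ.LFunction s)⁻¹ * (y : ℂ) ^ s * deltaW D s)
    (hℓ : 1 ≤ ell D) {c : ℝ} (hc : 0 < c) {ρ : ℝ} (hρ9 : 9 / 10 < ρ)
    (hLρ : χ.LFunction ρ = 0) (hL'ρ : deriv χ.LFunction ρ ≠ 0)
    (hzf : ∀ s : ℂ, 1 - c / (Real.log D + Real.log (|s.im| + 4)) ≤ s.re → s ≠ ρ →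
      χ.LFunction s ≠ 0)
    {a b T : ℝ} (ha9 : 9 / 10 < a) (haρ : a < ρ) (hρb : ρ < b) (hT : 0 < T)
    (haT : 1 - c / (Real.log D + Real.log (T + 4)) < a) :
    Literature.Analysis.Complex.rectBoundaryIntegral F a b (-T) T =
      2 * Real.pi * I * (G ρ * (y : ℂ) ^ (ρ : ℂ) * deltaW D ρ / deriv χ.LFunction ρ) := by
  set U : Set ℂ := {s : ℂ | 9 / 10 < s.re ∧ 1 - c / (Real.log D + Real.log (|s.im| + 4)) < s.re}
    with hU
  have hUopen : IsOpen U := isOpen_region c D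
  have hab : a < b := haρ.trans hρb
  have hTT : -T < T := by linarith
  -- the closed rectangle lies in `U`
  have hKU : Icc a b ×ℂ Icc (-T) T ⊆ U := by
    intro z hz
    rw [Complex.mem_reProdIm] at hz
    refine ⟨lt_of_lt_of_le ha9 hz.1.1, ?_⟩
    have him : |z.im| ≤ T := abs_le.mpr hz.2
    calc 1 - c / (Real.log D + Real.log (|z.im| + 4))
        ≤ 1 - c / (Real.log D + Real.log (T + 4)) := region_mono hc.le D him
      _ < a := haT
      _ ≤ z.re := hz.1.1
  -- the pole set
  set S : Finset ℂ := {(ρ : ℂ)} with hS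
  have hSsub : ((S : Set ℂ)) ⊆ Ioo a b ×ℂ Ioo (-T) T := by
    intro q hq
    rw [hS, Finset.coe_singleton, Set.mem_singleton_iff] at hq
    subst hq
    rw [Complex.mem_reProdIm]
    refine ⟨?_, ?_⟩
    · simp only [Complex.ofReal_re]; exact ⟨haρ, hρb⟩
    · simp only [Complex.ofReal_im]; exact ⟨by linarith, hT⟩
  -- holomorphy off the pole
  have hFdiff : DifferentiableOn ℂ F (U \ (S : Set ℂ)) := by
    intro z hz
    have hzU : z ∈ U := hz.1
    have hzρ : z ≠ (ρ : ℂ) := by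
      intro h; apply hz.2; rw [hS, Finset.coe_singleton]; exact h
    exact (differentiableAt_integrand hχ hG hy hF hℓ hzU.1 (hzf z hzU.2.le hzρ)).differentiableWithinAt
  -- the simple pole
  obtain ⟨φ, V, hV, hφd, hφρ, hφ⟩ := exists_pole_form hχ hG hy hF hℓ hρ9 hLρ hL'ρ
  set r : ℂ → ℂ := fun _ => G ρ * (y : ℂ) ^ (ρ : ℂ) * deltaW D ρ / deriv χ.LFunction ρ with hr
  have hpole : ∀ q ∈ S, ∃ φ : ℂ → ℂ, ∃ V ∈ 𝓝 q, DifferentiableOn ℂ φ V ∧ φ q = r q ∧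
      ∀ z ∈ V, z ≠ q → F z = φ z / (z - q) := by
    intro q hq
    rw [hS, Finset.mem_singleton] at hq
    subst hq
    exact ⟨φ, V, hV, hφd, hφρ, hφ⟩
  have h := Literature.Analysis.Complex.rectBoundaryIntegral_eq_sum_of_simplePoles hab hTT S F r U
    hUopen hKU hSsub hFdiff hpole
  rw [h, hS, Finset.sum_singleton]

end Rectangle

/-! ## §3. Bounds for the pieces of the shifted contour -/

section Pieces

variable {D : ℕ} [NeZero D] {χ : DirichletCharacter ℂ D} {G F : ℂ → ℂ} {y : ℝ}

/-- **Pointwise size of the integrand**: with `‖G(s)‖ ≤ M`, `‖L(s,χ)⁻¹‖ ≤ Λ` and Lemma 5.4 (i),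
`‖F(s)‖ ≤ M·Λ·y^σ·(C_δ𝓛⁵¹⁹⁰)·‖s‖⁻²` (`1/2 ≤ σ ≤ 2`, `y > 0`). [cite: Zhang2022LandauSiegel, §5 Lemma 5.4 (i)] -/
theorem norm_integrand_le_pt (hy : 0 < y)
    (hF : ∀ s, F s = G s * (χ.LFunction s)⁻¹ * (y : ℂ) ^ s * deltaW D s)
    {Cδ : ℝ} (hCδ : ∀ s : ℂ, 1 / 2 ≤ s.re → s.re ≤ 2 → ‖deltaW D s‖ ≤ Cδ * ell D ^ 5190 * ‖s‖⁻¹ ^ 2)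
    {s : ℂ} (hs1 : 1 / 2 ≤ s.re) (hs2 : s.re ≤ 2) {M Λ : ℝ} (hM : 0 ≤ M) (hΛ : 0 ≤ Λ)
    (hGs : ‖G s‖ ≤ M) (hLs : ‖(χ.LFunction s)⁻¹‖ ≤ Λ) :
    ‖F s‖ ≤ M * Λ * y ^ s.re * (Cδ * ell D ^ 5190 * ‖s‖⁻¹ ^ 2) := by
  rw [hF s, norm_mul, norm_mul, norm_mul, Complex.norm_cpow_eq_rpow_re_of_pos hy]
  have hy' : 0 ≤ y ^ s.re := Real.rpow_nonneg hy.le _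
  have h4 := hCδ s hs1 hs2
  calc ‖G s‖ * ‖(χ.LFunction s)⁻¹‖ * y ^ s.re * ‖deltaW D s‖
      ≤ M * Λ * y ^ s.re * (Cδ * ell D ^ 5190 * ‖s‖⁻¹ ^ 2) := by
        gcongr
    _ = _ := rfl

/-- `‖∫_{t > T} H(t) dt‖ ≤ K/T` when `‖H(t)‖ ≤ K·t⁻²` for `t > T > 0` and `H` is integrable there.
[folklore] -/
private theorem norm_setIntegral_Ioi_le {H : ℝ → ℂ} {K T : ℝ} (hT : 0 < T) (hK : 0 ≤ K)
    (hH : ∀ t : ℝ, T < t → ‖H t‖ ≤ K * (t ^ 2)⁻¹) :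
    ‖∫ t in Ioi T, H t‖ ≤ K / T := by
  obtain ⟨hgi, hg⟩ := Literature.Analysis.Complex.integral_Ioi_inv_pow_le hT (k := 1) le_rfl
  have hgi' : Integrable (fun t : ℝ => K * (t ^ 2)⁻¹) (volume.restrict (Ioi T)) := by
    have := hgi.const_mul K
    simpa using this
  have h1 : ‖∫ t in Ioi T, H t‖ ≤ ∫ t in Ioi T, K * (t ^ 2)⁻¹ := by
    refine norm_integral_le_of_norm_le hgi' ?_
    exact ae_restrict_of_forall_mem measurableSet_Ioi fun t ht => hH t ht
  refine h1.trans ?_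
  rw [integral_const_mul]
  have hg' : ∫ t in Ioi T, (t ^ 2)⁻¹ ≤ 1 / T := by
    have := hg
    simpa using this
  calc K * ∫ t in Ioi T, (t ^ 2)⁻¹ ≤ K * (1 / T) := mul_le_mul_of_nonneg_left hg' hK
    _ = K / T := by ring

/-- **The two far pieces of the line `σ = b`** (`1 < b ≤ 2`, `|t| ≥ T > 0`): each has norm at most
`M·(b/(b−1))·y^b·(C_δ𝓛⁵¹⁹⁰)/T` (`‖L⁻¹‖ ≤ b/(b−1)`, `|yˢ| = y^b`, `‖s‖⁻² ≤ t⁻²`, `∫_T^∞t⁻²dt = 1/T`).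
[cite: Zhang2022LandauSiegel, §7 p.40; §15 p.82] -/
theorem norm_far_pieces_le
    (hy : 1 ≤ y) (hF : ∀ s, F s = G s * (χ.LFunction s)⁻¹ * (y : ℂ) ^ s * deltaW D s)
    {Cδ : ℝ} (hCδ0 : 0 ≤ Cδ)
    (hCδ : ∀ s : ℂ, 1 / 2 ≤ s.re → s.re ≤ 2 → ‖deltaW D s‖ ≤ Cδ * ell D ^ 5190 * ‖s‖⁻¹ ^ 2)
    {b M T : ℝ} (hb : 1 < b) (hb2 : b ≤ 2) (hM : 0 ≤ M) (hT : 0 < T)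
    (hGM : ∀ s : ℂ, b ≤ s.re → s.re ≤ 2 → ‖G s‖ ≤ M) :
    ‖∫ t in Ioi T, F ((b : ℂ) + t * I)‖ ≤ M * (b / (b - 1)) * y ^ b * (Cδ * ell D ^ 5190) / T ∧
      ‖∫ t in Iic (-T), F ((b : ℂ) + t * I)‖ ≤ M * (b / (b - 1)) * y ^ b * (Cδ * ell D ^ 5190) / T := by
  have hy0 : 0 < y := by linarith
  have hb0 : 0 ≤ b / (b - 1) := div_nonneg (by linarith) (by linarith)
  set K : ℝ := M * (b / (b - 1)) * y ^ b * (Cδ * ell D ^ 5190) with hK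
  have hK0 : 0 ≤ K := by
    have : 0 ≤ y ^ b := Real.rpow_nonneg hy0.le _
    positivity
  -- pointwise bound on the whole line `σ = b`
  have hpt : ∀ t : ℝ, t ≠ 0 → ‖F ((b : ℂ) + t * I)‖ ≤ K * (t ^ 2)⁻¹ := by
    intro t ht
    have hre : ((b : ℂ) + t * I).re = b := by simp
    have him : ((b : ℂ) + t * I).im = t := by simp
    have hL := (Lemma84.inv_LFunction_le_right χ (a := b - 1) (by linarith)
      (s := (b : ℂ) + t * I) (by rw [hre]; linarith)).2
    rw [show (1 + (b - 1)) / (b - 1) = b / (b - 1) by ring_nf] at hL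
    have h := norm_integrand_le_pt hy0 hF hCδ (s := (b : ℂ) + t * I) (by rw [hre]; linarith)
      (by rw [hre]; exact hb2) hM hb0 (hGM _ (by rw [hre]) (by rw [hre]; exact hb2)) hL
    rw [hre] at h
    refine h.trans ?_
    have hns : t ^ 2 ≤ ‖(b : ℂ) + t * I‖ ^ 2 := by
      rw [Complex.sq_norm, Complex.normSq_apply, hre, him]; nlinarith
    have ht2 : 0 < t ^ 2 := by positivity
    have hinv : ‖(b : ℂ) + t * I‖⁻¹ ^ 2 ≤ (t ^ 2)⁻¹ := by
      rw [inv_pow]; exact inv_anti₀ ht2 hns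
    have hyb0 : 0 ≤ y ^ b := Real.rpow_nonneg hy0.le _
    calc M * (b / (b - 1)) * y ^ b * (Cδ * ell D ^ 5190 * ‖(b : ℂ) + t * I‖⁻¹ ^ 2)
        ≤ M * (b / (b - 1)) * y ^ b * (Cδ * ell D ^ 5190 * (t ^ 2)⁻¹) := by gcongr
      _ = K * (t ^ 2)⁻¹ := by rw [hK]; ring
  refine ⟨norm_setIntegral_Ioi_le hT hK0 fun t ht => hpt t (by linarith), ?_⟩
  -- the lower tail, by reflection `t ↦ −t`
  have hrefl : (∫ t in Iic (-T), F ((b : ℂ) + t * I)) =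
      ∫ t in Ioi T, F ((b : ℂ) + ((-t : ℝ) : ℂ) * I) := by
    have h := integral_comp_neg_Iic (-T) (fun t : ℝ => F ((b : ℂ) + ((-t : ℝ) : ℂ) * I))
    simp only [neg_neg] at h
    rw [← h]
  rw [hrefl]
  refine norm_setIntegral_Ioi_le hT hK0 fun t ht => ?_
  have h := hpt (-t) (by linarith)
  rw [neg_sq] at h
  exact h

/-- **The left side `σ = a`, `|t| ≤ T`** (`1/2 ≤ a ≤ 2`): if `‖G(a+it)‖ ≤ M` and
`‖L(a+it,χ)⁻¹‖ ≤ Λ` for `|t| ≤ T`, then `‖∫_{−T}^{T} F(a+it)dt‖ ≤ M·Λ·y^a·(C_δ𝓛⁵¹⁹⁰)·4π`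
(`‖a+it‖⁻² ≤ 4(1+t²)⁻¹`, `∫(1+t²)⁻¹ = π`). [cite: Zhang2022LandauSiegel, §7 p.40; §15 p.82] -/
theorem norm_left_piece_le (hy : 0 < y)
    (hF : ∀ s, F s = G s * (χ.LFunction s)⁻¹ * (y : ℂ) ^ s * deltaW D s)
    {Cδ : ℝ} (hCδ0 : 0 ≤ Cδ)
    (hCδ : ∀ s : ℂ, 1 / 2 ≤ s.re → s.re ≤ 2 → ‖deltaW D s‖ ≤ Cδ * ell D ^ 5190 * ‖s‖⁻¹ ^ 2)
    {a M Λ T : ℝ} (ha : 1 / 2 ≤ a) (ha2 : a ≤ 2) (hM : 0 ≤ M) (hΛ : 0 ≤ Λ) (hT : 0 ≤ T)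
    (hGM : ∀ t : ℝ, |t| ≤ T → ‖G ((a : ℂ) + t * I)‖ ≤ M)
    (hLΛ : ∀ t : ℝ, |t| ≤ T → ‖(χ.LFunction ((a : ℂ) + t * I))⁻¹‖ ≤ Λ) :
    ‖∫ t in (-T)..T, F ((a : ℂ) + t * I)‖ ≤ M * Λ * y ^ a * (Cδ * ell D ^ 5190) * (4 * π) := by
  set K : ℝ := M * Λ * y ^ a * (Cδ * ell D ^ 5190) with hK
  have hK0 : 0 ≤ K := by
    have : 0 ≤ y ^ a := Real.rpow_nonneg hy.le _
    positivity
  -- pointwise bound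
  have hpt : ∀ t : ℝ, |t| ≤ T → ‖F ((a : ℂ) + t * I)‖ ≤ K * (4 * (1 + t ^ 2)⁻¹) := by
    intro t ht
    have hre : ((a : ℂ) + t * I).re = a := by simp
    have him : ((a : ℂ) + t * I).im = t := by simp
    have h := norm_integrand_le_pt hy hF hCδ (s := (a : ℂ) + t * I) (by rw [hre]; exact ha)
      (by rw [hre]; exact ha2) hM hΛ (hGM t ht) (hLΛ t ht)
    rw [hre] at h
    refine h.trans ?_
    have hns : (1 + t ^ 2) / 4 ≤ ‖(a : ℂ) + t * I‖ ^ 2 := by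
      rw [Complex.sq_norm, Complex.normSq_apply, hre, him]; nlinarith
    have hpos : 0 < (1 + t ^ 2) / 4 := by positivity
    have hinv : ‖(a : ℂ) + t * I‖⁻¹ ^ 2 ≤ 4 * (1 + t ^ 2)⁻¹ := by
      rw [inv_pow]
      calc (‖(a : ℂ) + t * I‖ ^ 2)⁻¹ ≤ ((1 + t ^ 2) / 4)⁻¹ := inv_anti₀ hpos hns
        _ = 4 * (1 + t ^ 2)⁻¹ := by rw [inv_div]; ring
    have hya0 : 0 ≤ y ^ a := Real.rpow_nonneg hy.le _
    calc M * Λ * y ^ a * (Cδ * ell D ^ 5190 * ‖(a : ℂ) + t * I‖⁻¹ ^ 2)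
        ≤ M * Λ * y ^ a * (Cδ * ell D ^ 5190 * (4 * (1 + t ^ 2)⁻¹)) := by gcongr
      _ = K * (4 * (1 + t ^ 2)⁻¹) := by rw [hK]; ring
  have hTT : -T ≤ T := by linarith
  have hgi : Integrable fun t : ℝ => K * (4 * (1 + t ^ 2)⁻¹) :=
    (integrable_inv_one_add_sq.const_mul 4).const_mul K
  have h1 : ‖∫ t in (-T)..T, F ((a : ℂ) + t * I)‖ ≤ ∫ t in (-T)..T, K * (4 * (1 + t ^ 2)⁻¹) := by
    refine intervalIntegral.norm_integral_le_of_norm_le hTT ?_ (hgi.intervalIntegrable)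
    exact Eventually.of_forall fun t ht => hpt t (abs_le.mpr ⟨by linarith [ht.1], ht.2⟩)
  have h2 : ∫ t in (-T)..T, K * (4 * (1 + t ^ 2)⁻¹) ≤ ∫ t : ℝ, K * (4 * (1 + t ^ 2)⁻¹) := by
    rw [intervalIntegral.integral_of_le hTT]
    exact setIntegral_le_integral hgi (Eventually.of_forall fun t => by
      have : 0 ≤ (4 * (1 + t ^ 2)⁻¹ : ℝ) := by positivity
      exact mul_nonneg hK0 this)
  have h3 : ∫ t : ℝ, K * (4 * (1 + t ^ 2)⁻¹) = K * (4 * π) := by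
    rw [integral_const_mul, integral_const_mul, integral_univ_inv_one_add_sq]
  linarith [h1, h2, h3.le]

/-- **A horizontal piece `σ ∈ [a, b]`, `t = τ`** (`|τ| ≥ 1`, `1/2 ≤ a ≤ b ≤ 2`, `y ≥ 1`): if
`‖G‖ ≤ M` and `‖L⁻¹‖ ≤ Λ` on it, then `‖∫_a^b F(σ+iτ)dσ‖ ≤ (b−a)·M·Λ·y^b·(C_δ𝓛⁵¹⁹⁰)/τ²`.
[cite: Zhang2022LandauSiegel, §7 p.40; §15 p.82] -/
theorem norm_horizontal_piece_le (hy : 1 ≤ y)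
    (hF : ∀ s, F s = G s * (χ.LFunction s)⁻¹ * (y : ℂ) ^ s * deltaW D s)
    {Cδ : ℝ} (hCδ0 : 0 ≤ Cδ)
    (hCδ : ∀ s : ℂ, 1 / 2 ≤ s.re → s.re ≤ 2 → ‖deltaW D s‖ ≤ Cδ * ell D ^ 5190 * ‖s‖⁻¹ ^ 2)
    {a b M Λ τ : ℝ} (ha : 1 / 2 ≤ a) (hab : a ≤ b) (hb2 : b ≤ 2) (hM : 0 ≤ M) (hΛ : 0 ≤ Λ)
    (hτ : 1 ≤ |τ|)
    (hGM : ∀ σ : ℝ, σ ∈ Icc a b → ‖G ((σ : ℂ) + τ * I)‖ ≤ M)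
    (hLΛ : ∀ σ : ℝ, σ ∈ Icc a b → ‖(χ.LFunction ((σ : ℂ) + τ * I))⁻¹‖ ≤ Λ) :
    ‖∫ σ in a..b, F ((σ : ℂ) + τ * I)‖ ≤ (b - a) * (M * Λ * y ^ b * (Cδ * ell D ^ 5190) / τ ^ 2) := by
  have hy0 : 0 < y := by linarith
  have hτ2 : 0 < τ ^ 2 := by
    have h0 : τ ≠ 0 := by
      intro h; rw [h, abs_zero] at hτ; linarith
    positivity
  have hpt : ∀ σ : ℝ, σ ∈ Icc a b →
      ‖F ((σ : ℂ) + τ * I)‖ ≤ M * Λ * y ^ b * (Cδ * ell D ^ 5190) / τ ^ 2 := by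
    intro σ hσ
    have hre : ((σ : ℂ) + τ * I).re = σ := by simp
    have him : ((σ : ℂ) + τ * I).im = τ := by simp
    have h := norm_integrand_le_pt hy0 hF hCδ (s := (σ : ℂ) + τ * I) (by rw [hre]; linarith [hσ.1])
      (by rw [hre]; linarith [hσ.2]) hM hΛ (hGM σ hσ) (hLΛ σ hσ)
    rw [hre] at h
    refine h.trans ?_
    have hyσ : y ^ σ ≤ y ^ b := Real.rpow_le_rpow_of_exponent_le hy hσ.2
    have hns : τ ^ 2 ≤ ‖(σ : ℂ) + τ * I‖ ^ 2 := by
      rw [Complex.sq_norm, Complex.normSq_apply, hre, him]; nlinarith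
    have hinv : ‖(σ : ℂ) + τ * I‖⁻¹ ^ 2 ≤ (τ ^ 2)⁻¹ := by
      rw [inv_pow]; exact inv_anti₀ hτ2 hns
    have hyb0 : 0 ≤ y ^ b := Real.rpow_nonneg hy0.le _
    calc M * Λ * y ^ σ * (Cδ * ell D ^ 5190 * ‖(σ : ℂ) + τ * I‖⁻¹ ^ 2)
        ≤ M * Λ * y ^ b * (Cδ * ell D ^ 5190 * (τ ^ 2)⁻¹) := by gcongr
      _ = M * Λ * y ^ b * (Cδ * ell D ^ 5190) / τ ^ 2 := by ring
  have h := intervalIntegral.norm_integral_le_of_norm_le_const (a := a) (b := b)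
    (f := fun σ : ℝ => F ((σ : ℂ) + τ * I)) (C := M * Λ * y ^ b * (Cδ * ell D ^ 5190) / τ ^ 2)
    fun σ hσ => hpt σ (by rw [Set.uIoc_of_le hab] at hσ; exact ⟨hσ.1.le, hσ.2⟩)
  rw [abs_of_nonneg (sub_nonneg.mpr hab)] at h
  linarith [h]

end Pieces

/-! ## §4. Part 1 assembled: the line integral is the residue at `ρ` up to the contour pieces -/

section PartOne

variable {D : ℕ} [NeZero D] {χ : DirichletCharacter ℂ D} {G F : ℂ → ℂ} {y : ℝ}

/-- `‖(1/(2π) : ℂ)‖ = 1/(2π)`. [folklore] -/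
private theorem norm_inv_two_pi : ‖(1 / (2 * π) : ℂ)‖ = 1 / (2 * π) := by
  rw [show (1 / (2 * π) : ℂ) = ((1 / (2 * π) : ℝ) : ℂ) by push_cast; ring, Complex.norm_real,
    Real.norm_of_nonneg (by positivity)]

/-- **Part 1 (the contour move, abstract form).** With the notation above: `χ ≠ χ₀`, `y ≥ 1`,
`𝓛 ≥ 1`; `ρ > 9/10` a real simple zero of `L(·,χ)`, the only zero with
`σ ≥ 1 − c/(log D + log(|t|+4))`; a rectangle `[a,b] × [−T,T]` inside that region with
`1/2 ≤ a`, `9/10 < a < ρ < b`, `1 < b ≤ 2`, `T ≥ 1`; bounds `‖G‖ ≤ M` on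
`{a ≤ σ ≤ 2} ∩ ({|t| ≤ T} ∪ {σ ≥ b})`, `‖L⁻¹‖ ≤ Λₗ` on the left side and `‖L⁻¹‖ ≤ Λₕ` on the two
horizontal sides. Then
`‖(1/2πi)∫_{(2)} F − G(ρ)y^ρδ(ρ)/L′(ρ,χ)‖ ≤ (1/2π)·(2·M(b/(b−1))y^b C_δ𝓛⁵¹⁹⁰/T + MΛₗy^a C_δ𝓛⁵¹⁹⁰·4π
+ 2(b−a)MΛₕy^b C_δ𝓛⁵¹⁹⁰/T²)` — shift `σ = 2 → b`, split the line at `±T`, residue theorem on the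
rectangle, and the piece bounds of §3. [cite: Zhang2022LandauSiegel, §7 p.40; §15 p.82; §16 p.90]
[cite: Conway1978, Ch. V Thm. 2.2] -/
theorem norm_lineInt_sub_residue_le (hχ : χ ≠ 1)
    (hG : DifferentiableOn ℂ G {s : ℂ | 9 / 10 < s.re}) (hy : 1 ≤ y)
    (hF : ∀ s, F s = G s * (χ.LFunction s)⁻¹ * (y : ℂ) ^ s * deltaW D s) (hℓ : 1 ≤ ell D)
    {Cδ : ℝ} (hCδ0 : 0 ≤ Cδ)
    (hCδ : ∀ s : ℂ, 1 / 2 ≤ s.re → s.re ≤ 2 → ‖deltaW D s‖ ≤ Cδ * ell D ^ 5190 * ‖s‖⁻¹ ^ 2)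
    {c : ℝ} (hc : 0 < c) {ρ : ℝ} (hρ9 : 9 / 10 < ρ) (hLρ : χ.LFunction ρ = 0)
    (hL'ρ : deriv χ.LFunction ρ ≠ 0)
    (hzf : ∀ s : ℂ, 1 - c / (Real.log D + Real.log (|s.im| + 4)) ≤ s.re → s ≠ ρ →
      χ.LFunction s ≠ 0)
    {a b T M Λl Λh : ℝ} (ha : 1 / 2 ≤ a) (ha9 : 9 / 10 < a) (haρ : a < ρ) (hρb : ρ < b)
    (hb : 1 < b) (hb2 : b ≤ 2) (hT : 1 ≤ T) (haT : 1 - c / (Real.log D + Real.log (T + 4)) < a)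
    (hM : 0 ≤ M) (hΛl : 0 ≤ Λl) (hΛh : 0 ≤ Λh)
    (hGM : ∀ s : ℂ, a ≤ s.re → s.re ≤ 2 → (|s.im| ≤ T ∨ b ≤ s.re) → ‖G s‖ ≤ M)
    (hLl : ∀ t : ℝ, |t| ≤ T → ‖(χ.LFunction ((a : ℂ) + t * I))⁻¹‖ ≤ Λl)
    (hLh : ∀ σ : ℝ, σ ∈ Icc a b → ‖(χ.LFunction ((σ : ℂ) + T * I))⁻¹‖ ≤ Λh ∧
      ‖(χ.LFunction ((σ : ℂ) + ((-T : ℝ) : ℂ) * I))⁻¹‖ ≤ Λh) :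
    ‖(1 / (2 * π) : ℂ) * (∫ t : ℝ, F ((2 : ℝ) + t * I)) -
        G ρ * (y : ℂ) ^ (ρ : ℂ) * deltaW D ρ / deriv χ.LFunction ρ‖ ≤
      1 / (2 * π) * (2 * (M * (b / (b - 1)) * y ^ b * (Cδ * ell D ^ 5190) / T) +
        M * Λl * y ^ a * (Cδ * ell D ^ 5190) * (4 * π) +
        2 * ((b - a) * (M * Λh * y ^ b * (Cδ * ell D ^ 5190) / T ^ 2))) := by
  have hy0 : 0 < y := by linarith
  have hT0 : 0 < T := by linarith
  have hTT : -T ≤ T := by linarith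
  have hab : a ≤ b := (haρ.trans hρb).le
  -- `‖G‖ ≤ M` on the strip `b ≤ σ ≤ 2`
  have hGMb : ∀ s : ℂ, b ≤ s.re → s.re ≤ 2 → ‖G s‖ ≤ M := fun s h1 h2 =>
    hGM s (hab.trans h1) h2 (Or.inr h1)
  /- 1. the line shift and the split at `±T` -/
  have hshift := integral_line_two_eq hχ hG hy hF hℓ hCδ0 hCδ hb hb2 hM hGMb
  have hint : Integrable fun t : ℝ => F ((b : ℂ) + t * I) :=
    integrable_integrand_line hχ hG hy hF hℓ hCδ0 hCδ hb hM hGMb le_rfl hb2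
  have hsplit : ∫ t : ℝ, F ((b : ℂ) + t * I) =
      (∫ t in Iic (-T), F ((b : ℂ) + t * I)) +
        ((∫ t in (-T)..T, F ((b : ℂ) + t * I)) + ∫ t in Ioi T, F ((b : ℂ) + t * I)) := by
    rw [← intervalIntegral.integral_Iic_add_Ioi hint.integrableOn hint.integrableOn,
      ← Set.Ioc_union_Ioi_eq_Ioi hTT, setIntegral_union Set.Ioc_disjoint_Ioi_same measurableSet_Ioi
        hint.integrableOn hint.integrableOn, intervalIntegral.integral_of_le hTT]
  /- 2. the rectangle -/
  have hrect := rect_eq_residue hχ hG hy0 hF hℓ hc hρ9 hLρ hL'ρ hzf ha9 haρ hρb hT0 haT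
  rw [Literature.Analysis.Complex.rectBoundaryIntegral] at hrect
  /- 3. the piece bounds -/
  obtain ⟨hfar1, hfar2⟩ := norm_far_pieces_le hy hF hCδ0 hCδ hb hb2 hM hT0 hGMb
  have hleft := norm_left_piece_le hy0 hF hCδ0 hCδ ha (by linarith) hM hΛl hT0.le
    (fun t ht => hGM _ (by simp) (by simp; linarith) (Or.inl (by simpa using ht))) hLl
  have hT1 : 1 ≤ |T| := by rw [abs_of_pos hT0]; exact hT
  have hT1' : 1 ≤ |(-T : ℝ)| := by rw [abs_neg, abs_of_pos hT0]; exact hT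
  have htop := norm_horizontal_piece_le hy hF hCδ0 hCδ ha hab hb2 hM hΛh hT1
    (fun σ hσ => hGM _ (by simp; exact hσ.1) (by simp; linarith [hσ.2])
      (Or.inl (by simp [abs_of_pos hT0])))
    (fun σ hσ => (hLh σ hσ).1)
  have hbot := norm_horizontal_piece_le hy hF hCδ0 hCδ ha hab hb2 hM hΛh hT1'
    (fun σ hσ => hGM _ (by simp; exact hσ.1) (by simp; linarith [hσ.2])
      (Or.inl (by simp [abs_of_pos hT0])))
    (fun σ hσ => (hLh σ hσ).2)
  rw [neg_sq] at hbot
  /- 4. algebra -/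
  set V := ∫ t : ℝ, F ((2 : ℝ) + t * I) with hV
  set P1 := ∫ t in Iic (-T), F ((b : ℂ) + t * I) with hP1
  set P2 := ∫ t in Ioi T, F ((b : ℂ) + t * I) with hP2
  set Vm := ∫ t in (-T)..T, F ((b : ℂ) + t * I) with hVm
  set W := ∫ t in (-T)..T, F ((a : ℂ) + t * I) with hW
  set Tp := ∫ σ in a..b, F ((σ : ℂ) + T * I) with hTp
  set Bt := ∫ σ in a..b, F ((σ : ℂ) + ((-T : ℝ) : ℂ) * I) with hBt
  set R := G ρ * (y : ℂ) ^ (ρ : ℂ) * deltaW D ρ / deriv χ.LFunction ρ with hR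
  have hI2 : I * I = -1 := Complex.I_mul_I
  have hmid : Vm = 2 * π * R + W + I * Bt - I * Tp := by
    have h := hrect
    linear_combination (-I) * h + (Vm - W - 2 * π * R) * hI2
  have hπ : (π : ℂ) ≠ 0 := Complex.ofReal_ne_zero.mpr Real.pi_pos.ne'
  have hkey : (1 / (2 * π) : ℂ) * V - R = (1 / (2 * π) : ℂ) * (P1 + P2 + W + I * Bt - I * Tp) := by
    have hV2 : V = P1 + (Vm + P2) := by rw [hshift, hsplit]
    rw [hV2, hmid]
    field_simp
    ring
  rw [hkey, norm_mul, norm_inv_two_pi]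
  have hnI : ∀ z : ℂ, ‖I * z‖ = ‖z‖ := fun z => by rw [norm_mul, Complex.norm_I, one_mul]
  have hsum : ‖P1 + P2 + W + I * Bt - I * Tp‖ ≤ ‖P1‖ + ‖P2‖ + ‖W‖ + ‖Bt‖ + ‖Tp‖ := by
    calc ‖P1 + P2 + W + I * Bt - I * Tp‖ ≤ ‖P1 + P2 + W + I * Bt‖ + ‖I * Tp‖ := norm_sub_le _ _
      _ ≤ ‖P1 + P2 + W‖ + ‖I * Bt‖ + ‖I * Tp‖ := by gcongr; exact norm_add_le _ _
      _ ≤ ‖P1 + P2‖ + ‖W‖ + ‖I * Bt‖ + ‖I * Tp‖ := by gcongr; exact norm_add_le _ _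
      _ ≤ ‖P1‖ + ‖P2‖ + ‖W‖ + ‖I * Bt‖ + ‖I * Tp‖ := by gcongr; exact norm_add_le _ _
      _ = ‖P1‖ + ‖P2‖ + ‖W‖ + ‖Bt‖ + ‖Tp‖ := by rw [hnI, hnI]
  have hpos : 0 ≤ 1 / (2 * π) := by positivity
  calc 1 / (2 * π) * ‖P1 + P2 + W + I * Bt - I * Tp‖
      ≤ 1 / (2 * π) * (‖P1‖ + ‖P2‖ + ‖W‖ + ‖Bt‖ + ‖Tp‖) := mul_le_mul_of_nonneg_left hsum hpos
    _ ≤ _ := by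
        apply mul_le_mul_of_nonneg_left _ hpos
        linarith [hfar1, hfar2, hleft, htop, hbot]

end PartOne

end Literature.NumberTheory.LFunctions.Zhang2022.DeltaContourShift

end
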